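import Summits.ResolutionOfSingularities.KangarooAtlas.MizutaniExponentCriterion
import HarnessLib

/-!
# The Frobenius image of a subgroup scheme cut out by additive forms — I: the contraction along `expand p`, coordinate case

Cell `pub-rosobs`, Mizutani enclosure (seat mizutani-encloser-2, gen 9). AI-written; *AI review is weaker than expert
review*; NOT a resolution-of-singularities theorem (summit relevance C).

First of three files transcribing Mizutani 1973 **Lemma 2.7** (the image of a Hironaka scheme under the Frobenius
`F^m : (x_i) ↦ (x_i^{p^m})` of the ambient vector group) for points of `ℙ^n_k`; sequel `MizutaniExpandTransport.lean`,
end node `MizutaniFrobeniusImage.lean`.  For a levelwise family `N : ℕ → (subspaces of k^{n+1})` of coefficient vectors with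
ideal `famIdeal N = (Σ_i a_i X_i^{p^j} : j ≥ 0, a ∈ N j)` (`MizutaniSchemeDimension`), the scheme-theoretic image of
`V(famIdeal N)` under `F : (x_i) ↦ (x_i^p)` has ideal `(famIdeal N).comap (expand p)` (`MvPolynomial.expand p : Y_i ↦ X_i^p`):

* `expand_addForm` — `expand (p^m) (Σ a_j X_j^{p^e}) = Σ a_j X_j^{p^{e+m}}`; `famIdeal_shift_le_comap_expand` — the SHIFTED
  family `j ↦ N (j+m)` always lies in the image ideal;
* **`comap_expand_famIdeal_le_of_coord`** — THE ENGINE in the coordinate case: if the linear forms of `N` are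
  «coordinate-saturated» (`a ∈ N 0`, `a_i ≠ 0` ⇒ `e_i ∈ N 1`), then `(famIdeal N).comap (expand p) ≤ famIdeal (j ↦ N (j+1))`,
  by the `k[X^p]`-linear retraction `rootPart` of `expand p` (`MizutaniExpandDimension`: `rootPart (g(X^p)·s) = g · rootPart s`)
  and `rootPart (X_i · s) ∈ (X_i)` (`rootPart_X_mul_mem_span`).

The general family (a projective coordinate change adapted to `N 0`) and all `m` are in `MizutaniExpandTransport.lean`.

## References

* H. Mizutani, *Hironaka's additive group schemes*, Nagoya Math. J. 52 (1973) 85–95, Lemma 2.7 (p. 89–90). [Mizutani1973HironakaGroupSchemes]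
* T. Oda, *Hironaka's additive group scheme, II*, Publ. RIMS 19 (1983), §2 (p. 1168: `L_e`, `L_B`, the `k[F]`-module structure). [Oda1983HironakaGroupSchemeII]
-/

noncomputable section

open MvPolynomial Literature.AlgebraicGeometry.Resolution Literature.AlgebraicGeometry.Resolution.HironakaScheme
  Literature.RingTheory.MvPolynomial

namespace Summit.ResolutionOfSingularities.KangarooAtlas.Mizutani

universe u

/-! ## Additive forms under `expand` -/

section Family

variable (k : Type u) [Field k] (p : ℕ) [hp : Fact p.Prime] [CharP k p] {n : ℕ}

omit hp [CharP k p] in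
/-- `expand (p^m) (Σ_j a_j X_j^{p^e}) = Σ_j a_j X_j^{p^{e+m}}`: the Frobenius of the ambient vector group shifts the level
of an additive form. [cite: Mizutani1973HironakaGroupSchemes, Lemma 2.7 (p. 90: (x_0, …, x_n) → (x_0^{p^{e−e'}}, …))] -/
theorem expand_addForm (e m : ℕ) (a : Fin (n + 1) → k) :
    expand (p ^ m) (addForm k p e a) = addForm k p (e + m) a := by
  unfold addForm
  rw [map_sum]
  refine Finset.sum_congr rfl fun j _ => ?_
  rw [map_mul, expand_C, map_pow, expand_X, ← pow_mul, ← pow_add, add_comm m e]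

omit hp [CharP k p] in
/-- `expand p (Σ_j a_j X_j^{p^e}) = Σ_j a_j X_j^{p^{e+1}}`. [cite: Mizutani1973HironakaGroupSchemes, Lemma 2.7] -/
theorem expand_addForm_one (e : ℕ) (a : Fin (n + 1) → k) :
    expand p (addForm k p e a) = addForm k p (e + 1) a := by
  have h := expand_addForm k p e 1 a
  rwa [pow_one] at h

omit [CharP k p] in
/-- `F^m e_i = e_i`. [folklore] -/
theorem frobVec_single (m : ℕ) (i : Fin (n + 1)) : frobVec k p m (Pi.single i (1 : k)) = Pi.single i 1 := by
  funext j
  unfold frobVec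
  by_cases h : j = i
  · subst h; rw [Pi.single_eq_same, one_pow]
  · rw [Pi.single_eq_of_ne h, zero_pow (pow_ne_zero _ hp.out.ne_zero)]

variable (N : ℕ → Submodule k (Fin (n + 1) → k))

omit hp [CharP k p] in
/-- **The shifted forms lie in the Frobenius image**: `(Σ a_i Y_i^{p^j} : a ∈ N (j+m)) ≤ (famIdeal N).comap (expand p^m)`
(`expand (p^m)` of a generator of the left is a generator of `famIdeal N`). [cite: Mizutani1973HironakaGroupSchemes, Lemma 2.7] -/
theorem famIdeal_shift_le_comap_expand (m : ℕ) :
    famIdeal k p (fun j => N (j + m)) ≤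
      (famIdeal k p N).comap (expand (p ^ m) : MvPolynomial (Fin (n + 1)) k →ₐ[k] MvPolynomial (Fin (n + 1)) k) := by
  unfold famIdeal
  rw [Ideal.span_le]
  rintro _ ⟨_, ⟨j, rfl⟩, ⟨a, ha, rfl⟩⟩
  rw [SetLike.mem_coe, Ideal.mem_comap, expand_addForm]
  exact Ideal.subset_span (Set.mem_iUnion.mpr ⟨j + m, a, ha, rfl⟩)

omit hp [CharP k p] in
/-- `rootPart q (X_i · s) ∈ (X_i)`: a monomial of `X_i · s` all of whose exponents are divisible by `q` has `i`-exponent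
`≥ q`. [folklore] -/
theorem rootPart_X_mul_mem_span {q : ℕ} (hq : q ≠ 0) (i : Fin (n + 1)) (s : MvPolynomial (Fin (n + 1)) k) :
    rootPart k (n + 1) q (X i * s) ∈ Ideal.span ({X i} : Set (MvPolynomial (Fin (n + 1)) k)) := by
  classical
  have h : Ideal.span ({X i} : Set (MvPolynomial (Fin (n + 1)) k)) =
      Ideal.span (X '' ({i} : Set (Fin (n + 1)))) := by
    rw [Set.image_singleton]
  rw [h, mem_ideal_span_X_image]
  intro γ hγ
  refine ⟨i, Set.mem_singleton i, ?_⟩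
  rw [MvPolynomial.mem_support_iff, coeff_rootPart hq, coeff_X_mul'] at hγ
  intro hγi
  apply hγ
  rw [if_neg]
  intro hmem
  rw [Finsupp.mem_support_iff, Finsupp.smul_apply, smul_eq_mul, hγi, mul_zero] at hmem
  exact hmem rfl

variable {N}

omit [CharP k p] in
/-- **THE ENGINE, coordinate case.** For a levelwise family `N` whose linear forms are «coordinate-saturated»
(`a ∈ N 0`, `a_i ≠ 0` ⇒ `e_i ∈ N 1`): `(famIdeal N).comap (expand p) ≤ famIdeal (j ↦ N (j+1))`.  Proof: for `g` with
`g(X^p) = Σ gen · h`, apply the `k[X^p]`-linear retraction `rootPart` of `expand p`: a generator of level `j ≥ 1` is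
`expand p` of the level-`j−1` shifted generator, and `rootPart (X_i · h) ∈ (X_i)` with `X_i = addForm 0 e_i`, `e_i ∈ N 1`
(no `F`-stability needed in this case).
[cite: Mizutani1973HironakaGroupSchemes, Lemma 2.7] -/
theorem comap_expand_famIdeal_le_of_coord
    (hT : ∀ a ∈ N 0, ∀ i, a i ≠ 0 → (Pi.single i 1 : Fin (n + 1) → k) ∈ N 1) :
    (famIdeal k p N).comap (expand p : MvPolynomial (Fin (n + 1)) k →ₐ[k] MvPolynomial (Fin (n + 1)) k) ≤
      famIdeal k p (fun j => N (j + 1)) := by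
  classical
  have hp0 : p ≠ 0 := hp.out.ne_zero
  set I' : Ideal (MvPolynomial (Fin (n + 1)) k) := famIdeal k p (fun j => N (j + 1)) with hI'
  -- `X_i ∈ I'` whenever `e_i ∈ N 1`
  have hXmem : ∀ i, (Pi.single i 1 : Fin (n + 1) → k) ∈ N 1 → (X i : MvPolynomial (Fin (n + 1)) k) ∈ I' := by
    intro i hi
    have hX : addForm k p 0 (Pi.single i (1 : k)) = X i := by rw [addForm_zero_eq_linForm, linForm_single]
    rw [hI', ← hX]
    unfold famIdeal
    exact Ideal.subset_span (Set.mem_iUnion.mpr ⟨0, Pi.single i 1, by simpa using hi, rfl⟩)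
  -- key: `rootPart p (g * s) ∈ I'` for every `g ∈ famIdeal N` and every `s`
  have key : ∀ g ∈ famIdeal k p N, ∀ s, rootPart k (n + 1) p (g * s) ∈ I' := by
    intro g hg
    unfold famIdeal at hg
    refine Submodule.span_induction ?_ ?_ ?_ ?_ hg
    · rintro _ ⟨_, ⟨j, rfl⟩, ⟨a, ha, rfl⟩⟩ s
      cases j with
      | zero =>
        -- `addForm 0 a * s = Σ_i C(a_i) * (X_i * s)`
        have hsum : addForm k p 0 a * s = ∑ i, expand p (C (a i)) * (X i * s) := by
          unfold addForm
          rw [Finset.sum_mul]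
          refine Finset.sum_congr rfl fun i _ => ?_
          rw [expand_C, pow_zero, pow_one, mul_assoc]
        rw [hsum, map_sum]
        refine I'.sum_mem fun i _ => ?_
        rw [rootPart_expand_mul hp0]
        by_cases hai : a i = 0
        · rw [hai, C_0, zero_mul]; exact I'.zero_mem
        · refine Ideal.mul_mem_left _ _ ?_
          have hX : (X i : MvPolynomial (Fin (n + 1)) k) ∈ I' := hXmem i (hT a ha i hai)
          have hle : Ideal.span ({X i} : Set (MvPolynomial (Fin (n + 1)) k)) ≤ I' :=
            (Ideal.span_singleton_le_iff_mem _).mpr hX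
          exact hle (rootPart_X_mul_mem_span k hp0 i s)
      | succ j =>
        rw [← expand_addForm_one, rootPart_expand_mul hp0]
        refine Ideal.mul_mem_right _ _ ?_
        rw [hI']
        unfold famIdeal
        exact Ideal.subset_span (Set.mem_iUnion.mpr ⟨j, a, ha, rfl⟩)
    · intro s
      rw [zero_mul, map_zero]
      exact I'.zero_mem
    · intro g₁ g₂ _ _ h₁ h₂ s
      rw [add_mul, map_add]
      exact I'.add_mem (h₁ s) (h₂ s)
    · intro r g _ hg s
      rw [smul_eq_mul, mul_assoc, mul_left_comm]
      exact hg (r * s)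
  intro t ht
  rw [Ideal.mem_comap] at ht
  have h := key _ ht 1
  rwa [mul_one, rootPart_expand hp0] at h


end Family

end Summit.ResolutionOfSingularities.KangarooAtlas.Mizutani

end
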